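import Literature.NumberTheory.Sieve.IwaniecBilinearSieveWellFactorable
import Literature.NumberTheory.Sieve.HardyLittlewoodTwinSieveProofs
import Literature.NumberTheory.Sieve.BombieriAsymptoticSieveShiftedPrimes
import Mathlib.NumberTheory.Harmonic.Bounds
import Mathlib.Analysis.PSeries
import HarnessLib

/-!
# The twin-prime sieve at the Bombieri–Friedlander–Iwaniec level: remainder bookkeeping

Topic `Literature/NumberTheory/Sieve`; first of two files proving the CONDITIONAL reduction
`BombieriFriedlanderIwaniecTheorem10Pi → twinSieve_bfi` (Bombieri–Friedlander–Iwaniec, Acta Math. 156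
(1986), §1 Corollary 2: `π₂(x) ≤ (7/2 + ε) B x/log²x`, "an immediate consequence of Theorem 10 and of the
linear sieve result of [15]").  The linear sieve result of [15] in well-factorable form is
`Iwaniec1980b.WF.sifted_le_wellFactorable` (`IwaniecBilinearSieveWellFactorable.lean`); this file
supplies the bookkeeping that feeds its remainder for the twin sequence `𝒜(x) = {p + 2 : 2 < p ≤ x}`
(`Chen.twinSeq`) into BFI's Theorem 10 (`π`-form):

* `TwinSieveBFI.sum_mul_remainder_twinSeq_eq`: for every weight `λ`,
  `∑_{q ≤ N} λ(q) r(𝒜, q) = ∑_{q ≤ N, (q,2)=1} λ(q) (π(x; q, −2) − π(x)/φ(q)) + ∑_{3 ≤ q ≤ N odd} λ(q)/φ(q)`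
  (the first sum is literally the sum bounded by `BombieriFriedlanderIwaniecTheorem10Pi` at `a = −2`);
* `TwinSieveBFI.sum_junkSet_abs_remainder_le`: the remainders over the junk moduli of
  `IwaniecBilinearSieveWellFactorable.lean` (`q ≤ N` with `p² ∣ q` for a prime `u ≤ p < z`) total at
  most `6 x (1 + log x)³ / u`;
* `TwinSieveBFI.tendsto_sieveProduct_two_rpow_mul_log`: Mertens for the twin sieve product along
  `z = x^β`: `V(x^β) log x → (2/β) C₂ e^{−γ}`.

Everything is PROVED; no facts.

## References

* E. Bombieri, J. B. Friedlander, H. Iwaniec, *Primes in arithmetic progressions to large moduli*, Acta Math.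
  156 (1986), 203–251, §1 Corollary 2. [BombieriFriedlanderIwaniecActa1986]
* M. B. Nathanson, *Additive Number Theory: The Classical Bases*, GTM 164 (1996), §10.4. [Nathanson1996]
-/

open Finset Filter Topology

noncomputable section

namespace Literature.NumberTheory.Sieve

namespace TwinSieveBFI

open Chen ChenSieve SieveSequence

/-! ### The residue `−2` -/

/-- `(q, −2) = 1` in `ℤ` iff `q` is odd. [folklore] -/
theorem isCoprime_neg_two_iff_odd (q : ℕ) : IsCoprime (q : ℤ) (-2) ↔ Odd q := by
  rw [Int.isCoprime_iff_gcd_eq_one, Int.gcd_neg, show (2 : ℤ) = ((2 : ℕ) : ℤ) by norm_num,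
    Int.gcd_natCast_natCast, ← Nat.coprime_two_right]

/-- For odd `q ≥ 3`, the class of `−2` is the unit `negTwoUnit q`. [folklore] -/
theorem intCast_neg_two_eq_negTwoUnit {q : ℕ} (hq : Odd q) (hq3 : 3 ≤ q) :
    ((-2 : ℤ) : ZMod q) = ((negTwoUnit q : (ZMod q)ˣ) : ZMod q) := by
  rw [negTwoUnit, dif_pos (coprime_sub_two_of_odd hq (by omega)), ZMod.coe_unitOfCoprime,
    Nat.cast_sub (by omega : 2 ≤ q), ZMod.natCast_self, zero_sub]
  push_cast
  ring

/-- **The signed remainder of the twin sequence at an odd modulus `q ≥ 3`**: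
`r(q) = (π(x; q, −2) − π(x)/φ(q)) + 1/φ(q)` (`|A_q| = π(x; q, −2)`, `g(q)|A| = (π(x) − 1)/φ(q)`).
[cite: Nathanson1996, §10.4 (proof of Thm 10.4)] -/
theorem remainder_twinSeq_eq_of_odd {x q : ℕ} (hq : Odd q) (hq3 : 3 ≤ q) :
    (twinSeq x).remainder q ((x + 2 : ℕ) : ℝ) =
      ((LevelOfDistribution.primeCountingMod q (((-2 : ℤ) : ZMod q)).val x : ℝ) -
          (Nat.primeCounting x : ℝ) / Nat.totient q) + ((Nat.totient q : ℝ))⁻¹ := by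
  rw [SieveSequence.remainder, congrSum_twinSeq_eq hq hq3, intCast_neg_two_eq_negTwoUnit hq hq3,
    val_negTwoUnit hq hq3]
  change (LevelOfDistribution.primeCountingMod q (q - 2) x : ℝ) -
    shiftedPrimesDensity 2 q * ((Nat.primeCounting x : ℝ) - 1) = _
  rw [shiftedPrimesDensity_two_odd hq, div_eq_mul_inv]
  ring

/-- **Splitting `∑_q λ(q) r(𝒜, q)` into the Bombieri–Friedlander–Iwaniec sum and a trivial part**: for
`x ≥ 2`, every `N` and every weight `λ`,
`∑_{1 ≤ q ≤ N} λ(q) r(q) = ∑_{q ≤ N, (q, −2) = 1} λ(q) (π(x; q, −2) − π(x)/φ(q)) + ∑_{3 ≤ q ≤ N, q odd} λ(q)/φ(q)`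
(`r(q) = 0` for even `q`, `r(1) = 0`, and `π(x; 1, ·) − π(x) = 0`). [folklore] -/
theorem sum_mul_remainder_twinSeq_eq {x : ℕ} (hx : 2 ≤ x) (N : ℕ) (lam : ℕ → ℝ) :
    ∑ q ∈ Icc 1 N, lam q * (twinSeq x).remainder q ((x + 2 : ℕ) : ℝ) =
      (∑ q ∈ (Icc 1 N).filter (fun q : ℕ => IsCoprime (q : ℤ) (-2)),
          lam q * ((LevelOfDistribution.primeCountingMod q (((-2 : ℤ) : ZMod q)).val x : ℝ) -
            (Nat.primeCounting x : ℝ) / Nat.totient q)) +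
        ∑ q ∈ (Icc 1 N).filter (fun q : ℕ => Odd q ∧ 3 ≤ q), lam q / Nat.totient q := by
  classical
  -- both sides as sums over `Icc 1 N` of functions vanishing off the odd moduli
  rw [Finset.sum_filter, Finset.sum_filter, ← Finset.sum_add_distrib]
  refine Finset.sum_congr rfl fun q hq => ?_
  have hq1 : 1 ≤ q := (Finset.mem_Icc.mp hq).1
  rcases Nat.even_or_odd q with hev | hodd
  · rw [remainder_twinSeq_of_even hev, mul_zero, if_neg (fun h => ?_), if_neg (fun h => ?_), add_zero]
    · exact (Nat.not_even_iff_odd.mpr h.1) hev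
    · exact (Nat.not_even_iff_odd.mpr ((isCoprime_neg_two_iff_odd q).mp h)) hev
  rw [if_pos ((isCoprime_neg_two_iff_odd q).mpr hodd)]
  by_cases hq3 : 3 ≤ q
  · rw [if_pos ⟨hodd, hq3⟩, remainder_twinSeq_eq_of_odd hodd hq3]
    ring
  · -- `q = 1`
    have hq1' : q = 1 := by
      rcases hodd with ⟨k, rfl⟩; omega
    subst hq1'
    rw [if_neg (fun h => hq3 h.2), add_zero, remainder_twinSeq_one hx, mul_zero]
    have h0 : (LevelOfDistribution.primeCountingMod 1 (((-2 : ℤ) : ZMod 1)).val x : ℝ) -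
        (Nat.primeCounting x : ℝ) / Nat.totient 1 = 0 := by
      rw [primeCountingMod_sub_div_eq one_ne_zero, primeCountingDisc]
      refine Finset.sum_eq_zero fun n _ => ?_
      split_ifs
      · rw [apIndicator, if_pos (Subsingleton.elim _ _), Nat.totient_one, Nat.cast_one, div_one, sub_self]
      · rfl
    rw [h0, mul_zero]

/-- The trivial part is at most `N` in absolute value for `|λ| ≤ 1` (`φ(q) ≥ 1`). [folklore] -/
theorem abs_sum_div_totient_le (N : ℕ) {lam : ℕ → ℝ} (hlam : ∀ q, |lam q| ≤ 1) :
    |∑ q ∈ (Icc 1 N).filter (fun q : ℕ => Odd q ∧ 3 ≤ q), lam q / Nat.totient q| ≤ N := by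
  refine (Finset.abs_sum_le_sum_abs _ _).trans ?_
  calc ∑ q ∈ (Icc 1 N).filter (fun q : ℕ => Odd q ∧ 3 ≤ q), |lam q / Nat.totient q|
      ≤ ∑ q ∈ (Icc 1 N).filter (fun q : ℕ => Odd q ∧ 3 ≤ q), (1 : ℝ) := by
        refine Finset.sum_le_sum fun q hq => ?_
        have hq3 := (Finset.mem_filter.mp hq).2.2
        have hφ : (1 : ℝ) ≤ Nat.totient q := by exact_mod_cast Nat.totient_pos.mpr (by omega)
        rw [abs_div, abs_of_pos (show (0 : ℝ) < Nat.totient q by linarith)]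
        exact (div_le_one (by linarith)).mpr ((hlam q).trans hφ)
    _ ≤ ∑ _q ∈ Icc 1 N, (1 : ℝ) :=
        Finset.sum_le_sum_of_subset_of_nonneg (Finset.filter_subset _ _) fun _ _ _ => zero_le_one
    _ = N := by simp

/-! ### Trivial bounds for the remainder and the junk moduli -/

/-- `|A(x)| = π(x) − 1 ≤ x + 2`. [folklore] -/
theorem size_twinSeq_le {x : ℕ} (hx : 2 ≤ x) : (twinSeq x).size ((x + 2 : ℕ) : ℝ) ≤ x + 2 := by
  change (Nat.primeCounting x : ℝ) - 1 ≤ x + 2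
  rw [← card_twinSieveSet hx]
  have h := Finset.card_le_card (twinSieveSet_subset_Ioc x)
  rw [Nat.card_Ioc] at h
  exact_mod_cast h

/-- `0 ≤ |A(x)|` for `x ≥ 2`. [folklore] -/
theorem size_twinSeq_nonneg {x : ℕ} (hx : 2 ≤ x) : 0 ≤ (twinSeq x).size ((x + 2 : ℕ) : ℝ) := by
  change (0 : ℝ) ≤ (Nat.primeCounting x : ℝ) - 1
  rw [← card_twinSieveSet hx]
  exact Nat.cast_nonneg _

/-- **Trivial bound for one remainder**: for `x ≥ 2` and `1 ≤ q ≤ x`,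
`|r(𝒜, q)| ≤ 4 x (1 + log x)²/q` (`|A_q| ≤ (x+2)/q`, `g(q)|A| ≤ (x+2)/φ(q) ≤ 2x (1 + log q)²/q`). [folklore] -/
theorem abs_remainder_twinSeq_le_trivial {x q : ℕ} (hx : 2 ≤ x) (hq1 : 1 ≤ q) (hqx : q ≤ x) :
    |(twinSeq x).remainder q ((x + 2 : ℕ) : ℝ)| ≤ 4 * x * (1 + Real.log x) ^ 2 / q := by
  classical
  have hq0 : (0 : ℝ) < q := by exact_mod_cast hq1
  have hx0 : (0 : ℝ) < x := by exact_mod_cast (show 0 < x by omega)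
  have hx1 : (1 : ℝ) ≤ x := by exact_mod_cast (show 1 ≤ x by omega)
  have hx2 : (2 : ℝ) ≤ x := by exact_mod_cast hx
  have hlogx : 0 ≤ Real.log x := Real.log_nonneg hx1
  have hlogq : 0 ≤ Real.log q := Real.log_nonneg (by exact_mod_cast hq1)
  have hL1 : 1 ≤ (1 + Real.log x) ^ 2 := by nlinarith
  -- `0 ≤ A_q ≤ (x + 2)/q ≤ 2x/q`
  have hA0 : 0 ≤ (twinSeq x).congrSum q ((x + 2 : ℕ) : ℝ) :=
    Finset.sum_nonneg fun n _ => (twinSeq x).a_nonneg n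
  have hA : (twinSeq x).congrSum q ((x + 2 : ℕ) : ℝ) ≤ 2 * x / q := by
    have h1 : (twinSeq x).congrSum q ((x + 2 : ℕ) : ℝ) ≤ (#((Finset.Ioc 0 (x + 2)).filter (q ∣ ·)) : ℝ) := by
      rw [SieveSequence.congrSum, Nat.floor_natCast]
      change ∑ n ∈ (Finset.Ioc 0 (x + 2)).filter (q ∣ ·), twinWeight x n ≤ _
      calc ∑ n ∈ (Finset.Ioc 0 (x + 2)).filter (q ∣ ·), twinWeight x n
          ≤ ∑ _n ∈ (Finset.Ioc 0 (x + 2)).filter (q ∣ ·), (1 : ℝ) :=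
            Finset.sum_le_sum fun n _ => by unfold twinWeight; split_ifs <;> norm_num
        _ = _ := by simp
    rw [Nat.Ioc_filter_dvd_card_eq_div] at h1
    have h2 : (((x + 2) / q : ℕ) : ℝ) ≤ ((x + 2 : ℕ) : ℝ) / q := Nat.cast_div_le
    have h3 : ((x + 2 : ℕ) : ℝ) / q ≤ 2 * x / q := by
      apply div_le_div_of_nonneg_right _ hq0.le
      push_cast; linarith
    linarith
  -- `0 ≤ g(q) X ≤ (x + 2)(1 + log q)²/q ≤ 2 x (1 + log x)²/q`
  have hg0 : 0 ≤ (twinSeq x).density q * (twinSeq x).size ((x + 2 : ℕ) : ℝ) :=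
    mul_nonneg (shiftedPrimesDensity_nonneg 2 q) (size_twinSeq_nonneg hx)
  have hφ : ((Nat.totient q : ℝ))⁻¹ ≤ (1 + Real.log x) ^ 2 / q := by
    have hφ0 : (0 : ℝ) < Nat.totient q := by exact_mod_cast Nat.totient_pos.mpr hq1
    have h := natCast_div_totient_le q
    rw [div_le_iff₀ hφ0] at h
    rw [inv_le_iff_one_le_mul₀ hφ0, div_mul_eq_mul_div, one_le_div hq0]
    calc (q : ℝ) ≤ (1 + Real.log q) ^ 2 * Nat.totient q := h
      _ ≤ (1 + Real.log x) ^ 2 * Nat.totient q := by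
          gcongr
  have hg : (twinSeq x).density q * (twinSeq x).size ((x + 2 : ℕ) : ℝ) ≤ 2 * x * (1 + Real.log x) ^ 2 / q := by
    calc (twinSeq x).density q * (twinSeq x).size ((x + 2 : ℕ) : ℝ)
        ≤ ((Nat.totient q : ℝ))⁻¹ * (x + 2) :=
          mul_le_mul (shiftedPrimesDensity_le_totient_inv 2 q) (size_twinSeq_le hx) (size_twinSeq_nonneg hx)
            (by positivity)
      _ ≤ (1 + Real.log x) ^ 2 / q * (2 * x) := mul_le_mul hφ (by linarith) (by positivity) (by positivity)
      _ = 2 * x * (1 + Real.log x) ^ 2 / q := by ring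
  rw [SieveSequence.remainder]
  rw [abs_le]
  constructor
  · have : 2 * x * (1 + Real.log x) ^ 2 / q ≤ 4 * x * (1 + Real.log x) ^ 2 / q := by
      apply div_le_div_of_nonneg_right _ hq0.le; nlinarith
    linarith
  · have : 2 * x / q ≤ 2 * x * (1 + Real.log x) ^ 2 / q := by
      apply div_le_div_of_nonneg_right _ hq0.le; nlinarith
    have h4 : 2 * (x : ℝ) * (1 + Real.log x) ^ 2 / q ≤ 4 * x * (1 + Real.log x) ^ 2 / q := by
      apply div_le_div_of_nonneg_right _ hq0.le; nlinarith
    linarith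

/-- `∑_{1 ≤ q ≤ N, p² ∣ q} 1/q ≤ (1 + log N)/p²` (reindex `q = p² m` and use the harmonic bound). [folklore] -/
theorem sum_filter_sq_dvd_inv_le (N : ℕ) {p : ℕ} (hp : 1 ≤ p) :
    ∑ q ∈ (Icc 1 N).filter (fun q => p ^ 2 ∣ q), (q : ℝ)⁻¹ ≤ (1 + Real.log N) / (p : ℝ) ^ 2 := by
  classical
  have hp0 : 0 < p ^ 2 := pow_pos hp 2
  have hp0' : (0 : ℝ) < (p : ℝ) ^ 2 := by positivity
  -- the filtered set is contained in the image of `m ↦ p² m`, `m ∈ Icc 1 N`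
  have hsub : (Icc 1 N).filter (fun q => p ^ 2 ∣ q) ⊆ (Icc 1 N).image (fun m => p ^ 2 * m) := by
    intro q hq
    rw [Finset.mem_filter, Finset.mem_Icc] at hq
    obtain ⟨⟨hq1, hqN⟩, m, rfl⟩ := hq
    rw [Finset.mem_image]
    refine ⟨m, Finset.mem_Icc.mpr ⟨?_, ?_⟩, rfl⟩
    · rcases Nat.eq_zero_or_pos m with h | h
      · subst h; simp at hq1
      · exact h
    · exact le_trans (Nat.le_mul_of_pos_left m hp0) hqN
  have hinj : ∀ a ∈ Icc 1 N, ∀ b ∈ Icc 1 N, p ^ 2 * a = p ^ 2 * b → a = b := fun a _ b _ h =>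
    Nat.eq_of_mul_eq_mul_left hp0 h
  calc ∑ q ∈ (Icc 1 N).filter (fun q => p ^ 2 ∣ q), (q : ℝ)⁻¹
      ≤ ∑ q ∈ (Icc 1 N).image (fun m : ℕ => p ^ 2 * m), ((q : ℕ) : ℝ)⁻¹ :=
        Finset.sum_le_sum_of_subset_of_nonneg hsub fun q _ _ => inv_nonneg.mpr (Nat.cast_nonneg q)
    _ = ∑ m ∈ Icc 1 N, ((p ^ 2 * m : ℕ) : ℝ)⁻¹ := Finset.sum_image hinj
    _ = ((p : ℝ) ^ 2)⁻¹ * ∑ m ∈ Icc 1 N, (m : ℝ)⁻¹ := by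
        rw [Finset.mul_sum]
        refine Finset.sum_congr rfl fun m _ => ?_
        push_cast
        rw [mul_inv]
    _ ≤ ((p : ℝ) ^ 2)⁻¹ * (1 + Real.log N) := by
        refine mul_le_mul_of_nonneg_left ?_ (inv_nonneg.mpr hp0'.le)
        have h := harmonic_le_one_add_log N
        rw [harmonic_eq_sum_Icc] at h
        push_cast at h
        exact h
    _ = (1 + Real.log N) / (p : ℝ) ^ 2 := by rw [inv_mul_eq_div]

/-- `∑_{u ≤ p < z, p prime} 1/p² ≤ 2/u` for `u ≥ 1`. [folklore] -/
theorem sum_primes_inv_sq_le {u z : ℝ} (hu : 1 ≤ u) :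
    ∑ p ∈ (Nat.primesBelow ⌈z⌉₊).filter (fun p : ℕ => u ≤ (p : ℝ)), ((p : ℝ) ^ 2)⁻¹ ≤ 2 / u := by
  have hk : 1 ≤ ⌈u⌉₊ := Nat.one_le_iff_ne_zero.mpr (by
    rw [Ne, Nat.ceil_eq_zero, not_le]; linarith)
  calc ∑ p ∈ (Nat.primesBelow ⌈z⌉₊).filter (fun p : ℕ => u ≤ (p : ℝ)), ((p : ℝ) ^ 2)⁻¹
      ≤ ∑ i ∈ Ioo (⌈u⌉₊ - 1) ⌈z⌉₊, ((i : ℝ) ^ 2)⁻¹ := by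
        refine Finset.sum_le_sum_of_subset_of_nonneg (fun p hp => ?_) fun i _ _ => by positivity
        rw [Finset.mem_filter, Nat.mem_primesBelow] at hp
        rw [Finset.mem_Ioo]
        refine ⟨?_, hp.1.1⟩
        have : ⌈u⌉₊ ≤ p := Nat.ceil_le.mpr hp.2
        omega
    _ ≤ 2 / ((⌈u⌉₊ - 1 : ℕ) + 1) := sum_Ioo_inv_sq_le _ _
    _ ≤ 2 / u := by
        rw [Nat.cast_sub hk, Nat.cast_one, sub_add_cancel]
        exact div_le_div_of_nonneg_left (by norm_num) (by linarith) (Nat.le_ceil u)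

/-- **The junk remainders are negligible**: with `N = ⌊Q⌋ ≤ x`, `u ≥ 1` and `x ≥ 2`,
`∑_{q ∈ junk} |r(𝒜, q)| ≤ 8 x (1 + log x)³ / u` (`junk = junkSet D ε z`: `q ≤ N` with `p² ∣ q` for a prime
`u ≤ p < z`). [folklore] -/
theorem sum_junkSet_abs_remainder_le {D ε z : ℝ} {x : ℕ} (hx : 2 ≤ x)
    (hN : ⌊Iwaniec1980b.WF.levelQ D ε⌋₊ ≤ x) (hu : 1 ≤ Iwaniec1980b.Core.uu D ε) :
    ∑ q ∈ Iwaniec1980b.WF.junkSet D ε z, |(twinSeq x).remainder q ((x + 2 : ℕ) : ℝ)| ≤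
      8 * x * (1 + Real.log x) ^ 3 / Iwaniec1980b.Core.uu D ε := by
  classical
  set N := ⌊Iwaniec1980b.WF.levelQ D ε⌋₊ with hNdef
  set u := Iwaniec1980b.Core.uu D ε with hudef
  set Pset := (Nat.primesBelow ⌈z⌉₊).filter (fun p : ℕ => u ≤ (p : ℝ)) with hPset
  set J := Iwaniec1980b.WF.junkSet D ε z with hJ
  have hx0 : (0 : ℝ) < x := by exact_mod_cast (show 0 < x by omega)
  have hx1 : (1 : ℝ) ≤ x := by exact_mod_cast (show 1 ≤ x by omega)
  have hlogx : 0 ≤ Real.log x := Real.log_nonneg hx1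
  have hu0 : 0 < u := by linarith
  set c := 4 * x * (1 + Real.log x) ^ 2 with hc
  have hc0 : 0 ≤ c := by positivity
  -- termwise trivial bound
  have hJmem : ∀ q ∈ J, 1 ≤ q ∧ q ≤ N ∧ ∃ p ∈ Pset, p ^ 2 ∣ q := by
    intro q hq
    rw [hJ, Iwaniec1980b.WF.junkSet, Finset.mem_filter, Finset.mem_Icc] at hq
    obtain ⟨⟨hq1, hqN⟩, p, hp, hup, hpz, hdvd⟩ := hq
    refine ⟨hq1, hqN, p, ?_, hdvd⟩
    rw [hPset, Finset.mem_filter, Nat.mem_primesBelow]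
    exact ⟨⟨Nat.lt_ceil.mpr hpz, hp⟩, hup⟩
  have h1 : ∑ q ∈ J, |(twinSeq x).remainder q ((x + 2 : ℕ) : ℝ)| ≤ ∑ q ∈ J, c / q := by
    refine Finset.sum_le_sum fun q hq => ?_
    obtain ⟨hq1, hqN, -⟩ := hJmem q hq
    exact abs_remainder_twinSeq_le_trivial hx hq1 (hqN.trans hN)
  -- `∑_{q ∈ J} c/q ≤ ∑_{p ∈ Pset} ∑_{q ≤ N, p² ∣ q} c/q`
  have h2 : ∑ q ∈ J, c / q ≤ ∑ p ∈ Pset, ∑ q ∈ (Icc 1 N).filter (fun q => p ^ 2 ∣ q), c / q := by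
    calc ∑ q ∈ J, c / q ≤ ∑ q ∈ J, ∑ p ∈ Pset, (if p ^ 2 ∣ q then c / q else 0) := by
          refine Finset.sum_le_sum fun q hq => ?_
          obtain ⟨hq1, -, p, hp, hdvd⟩ := hJmem q hq
          have hnn : ∀ p' ∈ Pset, 0 ≤ (if p' ^ 2 ∣ q then c / q else 0) := fun p' _ => by
            split_ifs
            · positivity
            · exact le_rfl
          calc c / q = (if p ^ 2 ∣ q then c / q else 0) := by rw [if_pos hdvd]
            _ ≤ ∑ p' ∈ Pset, (if p' ^ 2 ∣ q then c / q else 0) := Finset.single_le_sum hnn hp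
      _ = ∑ p ∈ Pset, ∑ q ∈ J, (if p ^ 2 ∣ q then c / q else 0) := Finset.sum_comm
      _ = ∑ p ∈ Pset, ∑ q ∈ J.filter (fun q => p ^ 2 ∣ q), c / q := by
          refine Finset.sum_congr rfl fun p _ => ?_
          rw [Finset.sum_filter]
      _ ≤ ∑ p ∈ Pset, ∑ q ∈ (Icc 1 N).filter (fun q => p ^ 2 ∣ q), c / q := by
          refine Finset.sum_le_sum fun p _ => Finset.sum_le_sum_of_subset_of_nonneg (fun q hq => ?_)
            fun q _ _ => by positivity
          rw [Finset.mem_filter] at hq ⊢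
          obtain ⟨hq1, hqN, -⟩ := hJmem q hq.1
          exact ⟨Finset.mem_Icc.mpr ⟨hq1, hqN⟩, hq.2⟩
  -- inner sums by the harmonic bound, outer by `∑ 1/p² ≤ 2/u`
  have hlogN : Real.log N ≤ Real.log x := by
    rcases Nat.eq_zero_or_pos N with h0 | hpos
    · rw [h0, Nat.cast_zero, Real.log_zero]; exact hlogx
    · exact Real.log_le_log (by exact_mod_cast hpos) (by exact_mod_cast hN)
  have h3 : ∀ p ∈ Pset, ∑ q ∈ (Icc 1 N).filter (fun q => p ^ 2 ∣ q), c / q ≤ c * (1 + Real.log x) * ((p : ℝ) ^ 2)⁻¹ := by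
    intro p hp
    have hp1 : 1 ≤ p := (Nat.prime_of_mem_primesBelow (Finset.mem_filter.mp hp).1).one_lt.le
    have h := sum_filter_sq_dvd_inv_le N hp1
    calc ∑ q ∈ (Icc 1 N).filter (fun q => p ^ 2 ∣ q), c / q
        = c * ∑ q ∈ (Icc 1 N).filter (fun q => p ^ 2 ∣ q), (q : ℝ)⁻¹ := by
          rw [Finset.mul_sum]; refine Finset.sum_congr rfl fun q _ => ?_; rw [div_eq_mul_inv]
      _ ≤ c * ((1 + Real.log N) / (p : ℝ) ^ 2) := mul_le_mul_of_nonneg_left h hc0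
      _ ≤ c * ((1 + Real.log x) / (p : ℝ) ^ 2) := by gcongr
      _ = c * (1 + Real.log x) * ((p : ℝ) ^ 2)⁻¹ := by rw [div_eq_mul_inv]; ring
  have h4 := sum_primes_inv_sq_le (z := z) hu
  calc ∑ q ∈ J, |(twinSeq x).remainder q ((x + 2 : ℕ) : ℝ)|
      ≤ ∑ p ∈ Pset, ∑ q ∈ (Icc 1 N).filter (fun q => p ^ 2 ∣ q), c / q := h1.trans h2
    _ ≤ ∑ p ∈ Pset, c * (1 + Real.log x) * ((p : ℝ) ^ 2)⁻¹ := Finset.sum_le_sum h3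
    _ = c * (1 + Real.log x) * ∑ p ∈ Pset, ((p : ℝ) ^ 2)⁻¹ := by rw [Finset.mul_sum]
    _ ≤ c * (1 + Real.log x) * (2 / u) := mul_le_mul_of_nonneg_left h4 (by positivity)
    _ = 8 * x * (1 + Real.log x) ^ 3 / u := by rw [hc]; ring

/-! ### Mertens for the twin sieve product along `z = x^β` -/

/-- **`V(x^β) log x → (2/β) C₂ e^{−γ}`** as `x → ∞` through `ℕ`, for every `β > 0`
(`V(z) = ∏_{2<p<z}(1 − 1/(p−1)) = 2 U(z) T(z)`, `U(z) e^γ log z → 1` by Mertens' product theorem with rate,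
`T(z) → C₂`, and `log x = β⁻¹ log z`). [cite: HardyWright2008, Thm 429 (§22.8)] -/
theorem tendsto_sieveProduct_two_rpow_mul_log {β : ℝ} (hβ : 0 < β) :
    Tendsto (fun x : ℕ => sieveProduct 2 ((x : ℝ) ^ β) * Real.log x) atTop
      (𝓝 (2 / β * twinPrimeConst * Real.exp (-Real.eulerMascheroniConstant))) := by
  set G := Real.exp Real.eulerMascheroniConstant with hG
  have hG0 : 0 < G := Real.exp_pos _
  have hz : Tendsto (fun x : ℕ => (x : ℝ) ^ β) atTop atTop :=
    (tendsto_rpow_atTop hβ).comp tendsto_natCast_atTop_atTop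
  have hlogz : Tendsto (fun x : ℕ => Real.log ((x : ℝ) ^ β)) atTop atTop :=
    Real.tendsto_log_atTop.comp hz
  have hU : Tendsto (fun x : ℕ => (∏ p ∈ Nat.primesBelow ⌈(x : ℝ) ^ β⌉₊, (1 - (p : ℝ)⁻¹)) *
      (G * Real.log ((x : ℝ) ^ β))) atTop (𝓝 1) := by
    have h50 : Tendsto (fun x : ℕ => 50 / Real.log ((x : ℝ) ^ β)) atTop (𝓝 0) :=
      tendsto_const_nhds.div_atTop hlogz
    refine (tendsto_iff_norm_sub_tendsto_zero.mpr ?_)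
    refine squeeze_zero_norm' ?_ h50
    filter_upwards [hz.eventually_ge_atTop 2, hlogz.eventually_ge_atTop 25] with x hx2 hx25
    rw [norm_norm, Real.norm_eq_abs]
    exact abs_mertensFactor_sub_one_le hx2 hx25
  have hT : Tendsto (fun x : ℕ => twinPrimeConstPartial (⌈(x : ℝ) ^ β⌉₊ - 1)) atTop
      (𝓝 twinPrimeConst) := by
    have hlim : Tendsto twinPrimeConstPartial atTop (𝓝 twinPrimeConst) :=
      tendsto_twinPrimeConstPartial_holds
    exact hlim.comp ((tendsto_sub_atTop_nat 1).comp (tendsto_nat_ceil_atTop.comp hz))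
  have hprod := (hU.mul hT).mul_const (2 / (β * G))
  rw [one_mul] at hprod
  have hlimeq : twinPrimeConst * (2 / (β * G)) =
      2 / β * twinPrimeConst * Real.exp (-Real.eulerMascheroniConstant) := by
    rw [hG, Real.exp_neg]; field_simp
  rw [hlimeq] at hprod
  refine hprod.congr' ?_
  filter_upwards [hz.eventually_gt_atTop 2, eventually_gt_atTop 0] with x hx2 hx0
  have hx0' : (0 : ℝ) < x := by exact_mod_cast hx0
  rw [TwinSieveFour.sieveProduct_two_eq _ hx2, Real.log_rpow hx0']
  field_simp

end TwinSieveBFI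

end Literature.NumberTheory.Sieve

end
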